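import Mathlib
import Summits.NavierStokesRegularity.NavierStokesRegularity.Theorems.SubOnsagerCeilingSideBranchNoEscape
import Summits.NavierStokesRegularity.NavierStokesRegularity.Theorems.SubOnsagerCeilingOrthantInvariance
import HarnessLib

/-!
# `SubOnsagerCeiling.OrthantTailCeiling` (stmt-NavierStokesRegularity-25507) — negative lemma modulo
# ANOMALOUS ESCAPE of the side-branch table (`SideBranchEscape`)

The crux `OrthantTailCeiling` asks, for every spread `R ≥ 1`, every scale ratio `ε₀ ∈ (0,1]` and
every orthant table `α ∈ E₂(R)`, for `θ > 1/2` and `C ≥ 0` chosen BEFORE the viscosity such that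
every regular non-negative `ν`-viscous solution from a one-shell datum obeys the tail ceiling
`Σ_{k=n..N} Σ_i ½X_{i,k}(t)² ≤ C·E₀·(1+ε₀)^{-2θn}`.  It is REFUTED-MISSTATED IN NUMERICS by the
lead's side-branch dead-end table `α_SB = sideBranchTable ∈ E₂(10) ∩ orthant`
(`Cruxes/OrthantTailCeiling/REFUTATION-EVIDENCE.md`: parked pocket energies `≍ E₀(1+ε₀)^{-5n/9}`),
and `25507` is an aside of the route since rev 1.  This file turns the refutation into a KERNEL
theorem modulo ONE qualitative construction hypothesis, by a structural argument that does not
use the `5/9` law: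

* CEILING ⇒ NO ESCAPE (`sideBranch_not_escape_of_shellCeiling`, from the helper
  `SubOnsagerCeilingSideBranchNoEscape`): a dead-end pocket is an exact integrator of the side
  activity and the side mode an integrator of the chain energy, so ANY `ν`-uniform sub-Onsager
  per-shell ceiling (`θ > 1/2`) makes the bond flux out of the block of shells `0..K` as small as
  `Φ₁(1+ε₀)^{-(θ-1/2)K} + 2ν_K E_max T₀` — the energy of `α_SB` could then never leave the low
  shells (no anomalous dissipation in the inviscid limit on bounded windows);
* `SideBranchEscapeAt ε₀` / `SideBranchEscape := ∃ ε₀ ∈ (0,1], SideBranchEscapeAt ε₀` (`Prop`s,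
  NOTHING asserted): a fixed fraction `ρE₀` of the energy DOES
  leave every block `0..K` within a fixed time `T₀` at arbitrarily small viscosity — the
  Katz–Pavlović conveyor of `α_SB` keeps cascading through the weak side drain (numerically
  `≈ 10 %` of `E₀` is burned at the top of the resolved range, `ν`-stably; evidence, not proof);
* hence **`orthantTailCeiling_false_of_sideBranchEscape : SideBranchEscape → ¬ OrthantTailCeiling`**
  (the crux BY NAME, via
  `not_ceilingAt_sideBranch_of_escape` and the admissibility file `SubOnsagerCeilingSideBranchWitness`),
  and the same hypothesis kills the line «shell-barrier»: `not_shellBarrierAt_sideBranch_of_escape`,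
  `stub_barrierLargeRatio_false_of_sideBranchEscape`, `stub_barrierSmallRatio_false_of_sideBranchEscape`.

Composes with any reduction `ForwardTailCeiling → CeilingAt 10 ε₀ sideBranchTable` (sibling seat
ns-ow-p1, announced) to the same conditional refutation of the restated crux 26608.

WHY `SideBranchEscape` IS NOT CONSTRUCTIBLE HERE: a Lean witness needs, for EVERY depth `K`, a
certified regular solution of the infinite viscous lattice whose block `0..K` has lost `ρE₀` by
time `T₀` — the inviscid-limit cascade of `α_SB` (anomalous dissipation surviving the side drain)
at arbitrary depth; the tree has neither that asymptotics nor an anomalous-dissipation theorem for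
Katz–Pavlović networks with drains; numerics cannot supply "∀ K".

HONEST FRAMING: MODEL lattice ODEs only (Tao 2016 §4 vocabulary; rung TL-M2Break); nothing here is
a statement about the Navier–Stokes equations; the theorems are conditional refutations and
elementary energy bookkeeping — they settle nothing by themselves and no summit is proved.
Vocabulary: [cite: Tao2016AveragedNS, §4 (4.2)–(4.3), (4.5), (4.8), the viscous equation before
Thm. 4.2]; Katz–Pavlović couplings and their positivity: [cite: BarbatoMorandinRomito2011, §2].
-/

noncomputable section

-- the sub-problem namespace `NavierStokesRegularity.NavierStokesRegularity` is the tree's layout (D-0017)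
set_option linter.dupNamespace false

namespace Summit.NavierStokesRegularity.NavierStokesRegularity.Theorems.SubOnsagerCeiling

open Set Filter MeasureTheory intervalIntegral
open scoped Topology
open Literature.Analysis.FluidPDE.TaoCascade
open Summit.NavierStokesRegularity.NavierStokesRegularity.Theses.SubOnsagerCeiling

/-! ## §1 The construction hypothesis and CEILING ⇒ NO ESCAPE -/

/-- **`SideBranchEscapeAt ε₀` — the construction this negative lemma is modulo (ANOMALOUS ESCAPE of
the side-branch table at scale ratio `1+ε₀`).** There are a fraction `ρ > 0`, a horizon `T₀` and a
one-shell datum `X₀` of positive energy such that FOR EVERY DEPTH `K` and every viscosity threshold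
`ν₀ > 0` some regular solution of the `ν`-viscous `α_SB` lattice with `0 < ν ≤ ν₀` on a window
`[0,s]`, `s ≤ T₀` (one-shell datum `X₀` at shell `0`, vanishing below shell `0`, Tao's (4.5) weight
bound, continuous modes, the exact viscous equation within `[0,s]`), has lost at least the fraction
`ρ` of its energy from the block of shells `0..K` by time `s`:
`Σ_{k ≤ K} Σ_i ½X_{i,k}(s)² ≤ (1−ρ)·E₀` — the energy is beyond shell `K` or already burned.
This is the statement that the Katz–Pavlović conveyor of `α_SB` keeps cascading a fixed part of the
energy past every shell within a fixed time however small the viscosity (anomalous dissipation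
survives the weak side drain); numerically `≈ 10 %` of `E₀` is dissipated at the top of the
resolved range, `ν`-stably (lead's `Cruxes/OrthantTailCeiling/REFUTATION-EVIDENCE.md` §5, "E parked
0.88–0.90"). A `Prop`; NOTHING is asserted — a CONSTRUCTION TARGET, not a published fact (certifying
it needs the inviscid-limit dynamics of `α_SB` at arbitrary depth, which the tree cannot yet
construct). Vocabulary: [cite: Tao2016AveragedNS, §4 (4.5), (4.8), the viscous equation before
Thm. 4.2]. [this file] -/
def SideBranchEscapeAt (ε₀ : ℝ) : Prop :=
  ∃ ρ : ℝ, 0 < ρ ∧ ∃ T₀ : ℝ, 0 < T₀ ∧ ∃ X₀ : Fin 4 → ℝ, 0 < (∑ i : Fin 4, (1 / 2 : ℝ) * X₀ i ^ 2) ∧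
    ∀ K : ℕ, ∀ ν₀ : ℝ, 0 < ν₀ → ∃ ν : ℝ, 0 < ν ∧ ν ≤ ν₀ ∧ ∃ s : ℝ, 0 < s ∧ s ≤ T₀ ∧
      ∃ X : Fin 4 → ℤ → ℝ → ℝ,
        (∀ (i : Fin 4) (k : ℤ), X i k 0 = if k = 0 then X₀ i else 0) ∧
        (∀ (i : Fin 4) (k : ℤ), k < 0 → ∀ t : ℝ, X i k t = 0) ∧
        (∃ M : ℝ, ∀ (t : ℝ) (i : Fin 4) (k : ℤ), (1 + (1 + ε₀) ^ ((10 : ℝ) * k)) * |X i k t| ≤ M) ∧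
        (∀ (i : Fin 4) (k : ℤ), Continuous (X i k)) ∧
        (∀ (i : Fin 4) (k : ℤ), ∀ t ∈ Set.Icc (0 : ℝ) s, HasDerivWithinAt (X i k)
          (quadTerm ε₀ sideBranchTable X i k t - ν * (1 + ε₀) ^ ((2 : ℝ) * k) * X i k t)
          (Set.Icc (0 : ℝ) s) t) ∧
        (∑ k ∈ Finset.range (K + 1), ∑ i : Fin 4, (1 / 2 : ℝ) * X i (k : ℤ) s ^ 2) ≤
          (1 - ρ) * ∑ i : Fin 4, (1 / 2 : ℝ) * X₀ i ^ 2

/-- **CEILING ⇒ NO ESCAPE (the quantitative core).** If every regular non-negative `ν`-viscous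
solution of `α_SB` at scale ratio `1+ε₀` obeys the per-shell ceiling `Σ_i ½X_{i,k}(t)² ≤ C·E₀·b^{-2θk}`
(`θ > 1/2`, `C ≥ 0`, all shells, all times, all `ν` — this is what `CeilingAt 10 ε₀ sideBranchTable`
provides with `n = N = k`), then `SideBranchEscapeAt ε₀` fails: pockets meter the conveyor, so a deep
block `0..K` keeps all but `Φ₁ b^{-(θ-1/2)K} + 2ν_K E_max T₀` of the energy. [this file] -/
theorem sideBranch_not_escape_of_shellCeiling {ε₀ θ C : ℝ} (hε : 0 < ε₀) (hθ : 1 / 2 < θ) (hC : 0 ≤ C)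
    (hceil : ∀ ν : ℝ, 0 < ν → ∀ (X₀ : Fin 4 → ℝ) (s : ℝ), 0 < s → ∀ X : Fin 4 → ℤ → ℝ → ℝ,
      (∀ (i : Fin 4) (k : ℤ), X i k 0 = if k = 0 then X₀ i else 0) →
      (∀ (i : Fin 4) (k : ℤ), k < 0 → ∀ t : ℝ, X i k t = 0) →
      (∃ M : ℝ, ∀ (t : ℝ) (i : Fin 4) (k : ℤ), (1 + (1 + ε₀) ^ ((10 : ℝ) * k)) * |X i k t| ≤ M) →
      (∀ (i : Fin 4) (k : ℤ), Continuous (X i k)) →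
      (∀ (i : Fin 4) (k : ℤ), ∀ t ∈ Set.Icc (0 : ℝ) s, HasDerivWithinAt (X i k)
        (quadTerm ε₀ sideBranchTable X i k t - ν * (1 + ε₀) ^ ((2 : ℝ) * k) * X i k t)
        (Set.Icc (0 : ℝ) s) t) →
      (∀ t ∈ Set.Icc (0 : ℝ) s, ∀ (i : Fin 4) (k : ℤ), 1 ≤ k → 0 ≤ X i k t) →
      ∀ k : ℕ, ∀ t ∈ Set.Icc (0 : ℝ) s, ∑ i : Fin 4, (1 / 2 : ℝ) * X i (k : ℤ) t ^ 2 ≤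
        C * (∑ i : Fin 4, (1 / 2 : ℝ) * X₀ i ^ 2) * (1 + ε₀) ^ (-(2 * θ * (k : ℝ)))) :
    ¬ SideBranchEscapeAt ε₀ := by
  rintro ⟨ρ, hρ, T₀, hT₀, X₀, hE₀, hfam⟩
  have hb : (0 : ℝ) < 1 + ε₀ := by linarith
  have hb1 : (1 : ℝ) < 1 + ε₀ := by linarith
  set E₀ : ℝ := ∑ i : Fin 4, (1 / 2 : ℝ) * X₀ i ^ 2 with hE₀def
  set A : ℝ := Real.sqrt (2 * C * E₀) with hAdef
  have hA0 : 0 ≤ A := Real.sqrt_nonneg _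
  set Φ₁ : ℝ := (5 + T₀ / 2 + 25 * Real.exp 1 / 2 + Real.exp 1) * A ^ 2 +
    5 * Real.exp 1 / 2 * A ^ 3 + 5 * T₀ / 2 * A with hΦ₁def
  -- the decay factor `u_K = q^K`, `q = b^{-(θ-1/2)} < 1`; choose the depth `K`
  set q : ℝ := (1 + ε₀) ^ (-(θ - 1 / 2)) with hqdef
  have hq0 : 0 ≤ q := Real.rpow_nonneg hb.le _
  have hq1 : q < 1 := Real.rpow_lt_one_of_one_lt_of_neg hb1 (by linarith)
  have hρE : 0 < ρ * E₀ / 2 := by positivity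
  have htend : Tendsto (fun K : ℕ => Φ₁ * q ^ K) atTop (𝓝 (Φ₁ * 0)) :=
    (tendsto_pow_atTop_nhds_zero_of_lt_one hq0 hq1).const_mul Φ₁
  rw [mul_zero] at htend
  obtain ⟨K, hKsmall, hK1⟩ := ((htend.eventually (gt_mem_nhds hρE)).and
    (eventually_ge_atTop 1)).exists
  have hqK : (1 + ε₀) ^ (-((θ - 1 / 2) * (K : ℝ))) = q ^ K := by
    rw [show -((θ - 1 / 2) * (K : ℝ)) = (-(θ - 1 / 2)) * (K : ℝ) by ring,
      Real.rpow_mul_natCast hb.le]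
  -- choose the viscosity threshold
  set Emax : ℝ := C * E₀ * ((K : ℝ) + 1) with hEmaxdef
  have hEmax0 : 0 ≤ Emax := by positivity
  set D : ℝ := 8 * (1 + ε₀) ^ ((2 : ℝ) * (K : ℝ)) * Emax * T₀ + 1 with hDdef
  have hD0 : 0 < D := by positivity
  set ν₀ : ℝ := min 1 (min (1 / ((1 + ε₀) ^ ((2 : ℝ) * ((K : ℝ) + 1)) * T₀)) (ρ * E₀ / D))
    with hν₀def
  have hν₀ : 0 < ν₀ := lt_min one_pos (lt_min (by positivity) (by positivity))
  obtain ⟨ν, hν, hνle, s, hs, hsT, X, hinit, hlow, hbd, hcont, hder, hdef⟩ := hfam K ν₀ hν₀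
  have hν1 : ν ≤ 1 := hνle.trans (min_le_left _ _)
  have hν2 : ν ≤ 1 / ((1 + ε₀) ^ ((2 : ℝ) * ((K : ℝ) + 1)) * T₀) :=
    hνle.trans ((min_le_right _ _).trans (min_le_left _ _))
  have hν3 : ν ≤ ρ * E₀ / D := hνle.trans ((min_le_right _ _).trans (min_le_right _ _))
  -- cone invariance (item 25508, proved): non-negative on shells `≥ 1`
  have hpos : ∀ t ∈ Set.Icc (0 : ℝ) s, ∀ (i : Fin 4) (k : ℤ), 1 ≤ k → 0 ≤ X i k t :=
    orthantInvariance_proof ε₀ ν hε hν sideBranchTable sideBranchTable_orthant X₀ s hs X hinit hlow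
      hbd hcont hder
  -- the per-shell ceiling along `X` and the amplitude bounds
  have hshell : ∀ u ∈ Icc (0 : ℝ) s, ∀ k : ℕ, ∑ i : Fin 4, (1 / 2 : ℝ) * X i (k : ℤ) u ^ 2 ≤
      C * E₀ * (1 + ε₀) ^ (-(2 * θ * (k : ℝ))) :=
    fun u hu k => hceil ν hν X₀ s hs X hinit hlow hbd hcont hder hpos k u hu
  have hE₀0 : 0 ≤ E₀ := hE₀.le
  have habs : ∀ u ∈ Icc (0 : ℝ) s, ∀ (k : ℕ) (i : Fin 4),
      |X i (k : ℤ) u| ≤ A * (1 + ε₀) ^ (-(θ * (k : ℝ))) :=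
    fun u hu k i => sideBranch_abs_le_of_shellCeiling hε hC hE₀0 (hshell u hu k) i
  have hcast : ((K + 1 : ℕ) : ℤ) = (K : ℤ) + 1 := by push_cast; ring
  have hcastR : ((K + 1 : ℕ) : ℝ) = (K : ℝ) + 1 := by push_cast; ring
  have ha₀ : ∀ u ∈ Icc (0 : ℝ) s, |X 1 (K : ℤ) u| ≤ A * (1 + ε₀) ^ (-(θ * (K : ℝ))) :=
    fun u hu => habs u hu K 1
  have ha₁x : ∀ u ∈ Icc (0 : ℝ) s, |X 0 ((K : ℤ) + 1) u| ≤ A * (1 + ε₀) ^ (-(θ * ((K : ℝ) + 1))) :=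
    fun u hu => by rw [← hcast, ← hcastR]; exact habs u hu (K + 1) 0
  have ha₁z : ∀ u ∈ Icc (0 : ℝ) s, |X 2 ((K : ℤ) + 1) u| ≤ A * (1 + ε₀) ^ (-(θ * ((K : ℝ) + 1))) :=
    fun u hu => by rw [← hcast, ← hcastR]; exact habs u hu (K + 1) 2
  -- block bound `E_max`, empty side/pocket at time 0, the window condition
  have hE : ∀ u ∈ Icc (0 : ℝ) s, ∑ k ∈ Finset.range (K + 1), ∑ i : Fin 4,
      (1 / 2 : ℝ) * X i (k : ℤ) u ^ 2 ≤ Emax := by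
    intro u hu
    calc ∑ k ∈ Finset.range (K + 1), ∑ i : Fin 4, (1 / 2 : ℝ) * X i (k : ℤ) u ^ 2
        ≤ ∑ k ∈ Finset.range (K + 1), C * E₀ := Finset.sum_le_sum fun k _ =>
          (hshell u hu k).trans (mul_le_of_le_one_right (by positivity)
            (Real.rpow_le_one_of_one_le_of_nonpos hb1.le (by
              have : (0 : ℝ) ≤ k := Nat.cast_nonneg k
              nlinarith)))
      _ = Emax := by simp [hEmaxdef, Finset.sum_const, Finset.card_range]; ring
  have h10 : X 1 (K : ℤ) 0 = 0 := by rw [hinit, if_neg (by exact_mod_cast (by omega : K ≠ 0))]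
  have h20 : X 2 ((K : ℤ) + 1) 0 = 0 := by rw [hinit, if_neg (by omega)]
  have hss : s ∈ Icc (0 : ℝ) s := ⟨hs.le, le_rfl⟩
  have hP0 : 0 < (1 + ε₀) ^ ((2 : ℝ) * ((K : ℝ) + 1)) * T₀ := by positivity
  have hνt : ν * (1 + ε₀) ^ ((2 : ℝ) * ((K : ℝ) + 1)) * s ≤ 1 := by
    calc ν * (1 + ε₀) ^ ((2 : ℝ) * ((K : ℝ) + 1)) * s
        ≤ ν * (1 + ε₀) ^ ((2 : ℝ) * ((K : ℝ) + 1)) * T₀ := by gcongr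
      _ ≤ 1 / ((1 + ε₀) ^ ((2 : ℝ) * ((K : ℝ) + 1)) * T₀) *
            (1 + ε₀) ^ ((2 : ℝ) * ((K : ℝ) + 1)) * T₀ := by gcongr
      _ = 1 := by field_simp
  have hδ : (0 : ℝ) < (1 + ε₀) ^ (-((1 + θ) * (K : ℝ))) := Real.rpow_pos_of_pos hb _
  -- the estimate
  have hmain := sideBranch_noEscape_abstract hε hν.le hlow hcont hder K h10 h20 hδ hss ha₀ ha₁x
    ha₁z hE hνt
  have hrate := sideBranch_noEscape_rate hε hν1 hθ hA0 hs.le hsT K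
  dsimp only at hrate
  rw [hqK, ← hΦ₁def] at hrate
  -- dissipation of the block: `2 ν_K E_max s ≤ ρ E₀ / 4`
  have hdiss : 2 * (ν * (1 + ε₀) ^ ((2 : ℝ) * (K : ℝ))) * Emax * s ≤ ρ * E₀ / 4 := by
    have h1 : 2 * (ν * (1 + ε₀) ^ ((2 : ℝ) * (K : ℝ))) * Emax * s ≤
        2 * ((ρ * E₀ / D) * (1 + ε₀) ^ ((2 : ℝ) * (K : ℝ))) * Emax * T₀ := by gcongr
    have h2 : 2 * ((ρ * E₀ / D) * (1 + ε₀) ^ ((2 : ℝ) * (K : ℝ))) * Emax * T₀ =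
        ρ * E₀ / 4 * ((8 * (1 + ε₀) ^ ((2 : ℝ) * (K : ℝ)) * Emax * T₀) / D) := by
      field_simp
      ring
    have h3 : (8 * (1 + ε₀) ^ ((2 : ℝ) * (K : ℝ)) * Emax * T₀) / D ≤ 1 := by
      rw [div_le_one hD0, hDdef]
      linarith
    have h4 : ρ * E₀ / 4 * ((8 * (1 + ε₀) ^ ((2 : ℝ) * (K : ℝ)) * Emax * T₀) / D) ≤ ρ * E₀ / 4 :=
      mul_le_of_le_one_right (by positivity) h3
    linarith
  -- the block starts with all the energy
  have hB0 : (∑ k ∈ Finset.range (K + 1), ∑ i : Fin 4, (1 / 2 : ℝ) * X i (k : ℤ) 0 ^ 2) = E₀ := by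
    rw [Finset.sum_range_succ']
    have h1 : ∀ k : ℕ, (∑ i : Fin 4, (1 / 2 : ℝ) * X i ((k + 1 : ℕ) : ℤ) 0 ^ 2) = 0 := fun k =>
      Finset.sum_eq_zero fun i _ => by
        rw [hinit, if_neg (by push_cast; omega)]
        ring
    simp only [h1, Finset.sum_const_zero, zero_add]
    refine Finset.sum_congr rfl fun i _ => ?_
    rw [hinit, if_pos (by simp)]
  rw [hB0] at hmain
  have hρE₀ : 0 < ρ * E₀ := mul_pos hρ hE₀
  linarith

/-! ## §2 The conditional refutations: the crux by name, and the line «shell-barrier» -/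

/-- **`SideBranchEscapeAt ε₀ → ¬ CeilingAt 10 ε₀ α_SB`**: the body of the crux fails at the witness
table (the tail ceiling with `n = N = k` is a per-shell ceiling). [this file] -/
theorem not_ceilingAt_sideBranch_of_escape {ε₀ : ℝ} (hε : 0 < ε₀) (hH : SideBranchEscapeAt ε₀) :
    ¬ CeilingAt 10 ε₀ sideBranchTable := by
  intro hCeil
  obtain ⟨θ, hθ, C, hC, hceil⟩ := hCeil sideBranchTable_inTableClass sideBranchTable_orthant
  refine sideBranch_not_escape_of_shellCeiling hε hθ hC ?_ hH
  intro ν hν X₀ s hs X hinit hlow hbd hcont hder hpos k t ht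
  have h := hceil ν hν X₀ s hs X hinit hlow hbd hcont hder hpos k k le_rfl t ht
  simpa [Finset.Icc_self] using h

/-- **`SideBranchEscape` — the construction hypothesis in closed form**: anomalous escape of the
side-branch table at SOME scale ratio `ε₀ ∈ (0,1]` (`∃ ε₀ ∈ (0,1], SideBranchEscapeAt ε₀`). A `Prop`;
NOTHING is asserted; it is the hypothesis of `orthantTailCeiling_false_of_sideBranchEscape`, a
CONSTRUCTION TARGET and not a published fact. [this file] -/
def SideBranchEscape : Prop := ∃ ε₀ : ℝ, 0 < ε₀ ∧ ε₀ ≤ 1 ∧ SideBranchEscapeAt ε₀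

/-- **Negative lemma (conditional refutation of the crux BY NAME).**
`SideBranchEscape → ¬ OrthantTailCeiling` (`SideBranchEscape = ∃ ε₀ ∈ (0,1], SideBranchEscapeAt ε₀`):
the crux quantifies over all spreads
`R ≥ 1`, all scale ratios `ε₀ ∈ (0,1]` and all orthant tables of `E₂(R)`; `α_SB ∈ E₂(10)` is orthant
(`SubOnsagerCeilingSideBranchWitness`), and at `(10, ε₀, α_SB)` its body is refuted by
`not_ceilingAt_sideBranch_of_escape`. MODEL lattice only; conditional; settles nothing by itself.
[this file] -/
theorem orthantTailCeiling_false_of_sideBranchEscape (hH : SideBranchEscape) :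
    ¬ OrthantTailCeiling := by
  obtain ⟨ε₀, hε, hε1, hHε⟩ := hH
  intro hOTC
  rw [orthantTailCeiling_iff_ceilingAt] at hOTC
  exact not_ceilingAt_sideBranch_of_escape hε hHε (hOTC 10 (by norm_num) ε₀ hε hε1 sideBranchTable)

/-- **The shell barrier of the line «shell-barrier» also fails at `α_SB`, modulo escape**: a
`ν`-uniform weighted per-shell bound `(1+ε₀)^{2θk}·½X_{i,k}² ≤ D·E₀` is a per-shell ceiling with
`C = 4D`. [this file] -/
theorem not_shellBarrierAt_sideBranch_of_escape {ε₀ : ℝ} (hε : 0 < ε₀) (hH : SideBranchEscapeAt ε₀) :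
    ¬ ShellBarrierAt 10 ε₀ sideBranchTable := by
  intro hSB
  obtain ⟨θ, hθ, D, hD, hbar⟩ := hSB sideBranchTable_inTableClass sideBranchTable_orthant
  have hb : (0 : ℝ) < 1 + ε₀ := by linarith
  refine sideBranch_not_escape_of_shellCeiling hε hθ (by positivity : (0 : ℝ) ≤ 4 * D) ?_ hH
  intro ν hν X₀ s hs X hinit hlow hbd hcont hder hpos k t ht
  have h := hbar ν hν X₀ s hs X hinit hlow hbd hcont hder hpos t ht
  have hw : 0 < (1 + ε₀) ^ (2 * θ * (k : ℝ)) := Real.rpow_pos_of_pos hb _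
  have hinv : (1 + ε₀) ^ (-(2 * θ * (k : ℝ))) = ((1 + ε₀) ^ (2 * θ * (k : ℝ)))⁻¹ :=
    Real.rpow_neg hb.le _
  have hk : ∀ i : Fin 4, (1 / 2 : ℝ) * X i (k : ℤ) t ^ 2 ≤
      D * (∑ j : Fin 4, (1 / 2 : ℝ) * X₀ j ^ 2) * (1 + ε₀) ^ (-(2 * θ * (k : ℝ))) := by
    intro i
    rw [hinv, ← div_eq_mul_inv, le_div_iff₀ hw, mul_comm]
    exact h i k
  calc ∑ i : Fin 4, (1 / 2 : ℝ) * X i (k : ℤ) t ^ 2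
      ≤ ∑ _i : Fin 4, D * (∑ j : Fin 4, (1 / 2 : ℝ) * X₀ j ^ 2) * (1 + ε₀) ^ (-(2 * θ * (k : ℝ))) :=
        Finset.sum_le_sum fun i _ => hk i
    _ = 4 * D * (∑ j : Fin 4, (1 / 2 : ℝ) * X₀ j ^ 2) * (1 + ε₀) ^ (-(2 * θ * (k : ℝ))) := by
        rw [Finset.sum_const, Finset.card_univ, Fintype.card_fin]
        simp only [nsmul_eq_mul]
        push_cast
        ring

/-- The registered stub `Sig.stub_barrierLargeRatio` of the line «shell-barrier» is false modulo
escape at any ratio `ε₀ ∈ (1/4, 1]`. [this file] -/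
theorem stub_barrierLargeRatio_false_of_sideBranchEscape
    (hH : ∃ ε₀ : ℝ, 1 / 4 < ε₀ ∧ ε₀ ≤ 1 ∧ SideBranchEscapeAt ε₀) : ¬ Sig.stub_barrierLargeRatio := by
  obtain ⟨ε₀, hε, hε1, hHε⟩ := hH
  intro hstub
  exact not_shellBarrierAt_sideBranch_of_escape (by linarith) hHε
    (hstub 10 (by norm_num) ε₀ hε hε1 sideBranchTable)

/-- The registered stub `Sig.stub_barrierSmallRatio` of the line «shell-barrier» is false modulo
escape at any ratio `ε₀ ∈ (0, 1/4]`. [this file] -/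
theorem stub_barrierSmallRatio_false_of_sideBranchEscape
    (hH : ∃ ε₀ : ℝ, 0 < ε₀ ∧ ε₀ ≤ 1 / 4 ∧ SideBranchEscapeAt ε₀) : ¬ Sig.stub_barrierSmallRatio := by
  obtain ⟨ε₀, hε, hε1, hHε⟩ := hH
  intro hstub
  exact not_shellBarrierAt_sideBranch_of_escape hε hHε (hstub 10 (by norm_num) ε₀ hε hε1 sideBranchTable)

end Summit.NavierStokesRegularity.NavierStokesRegularity.Theorems.SubOnsagerCeiling

end
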